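import Mathlib
import HarnessLib
import HarnessLib.Audit
import Summits.CriticalPhenomena.Statement

/-!
Route: PercDebrisSweep

It suffices to show X_DS = (S) ∧ (K) [a subcritical exponent bound traded against the surface-order
law of finite clusters at a percolating parameter; card
CriticalPhenomena/PercolationContinuityZ3/debris-sweep-transfer]:
 (S) SubcritChiBelowCube: ∃ γ₀ < 3, C: for all p < p_c(ℤ³) and all R, Σ_{x ∈ B(R)} τ_p(0,x) ≤ C (p_c
− p)^{−γ₀} — the susceptibility χ(p) = E_p|C(0)| diverges no faster than (p_c − p)^{−γ₀} with some
γ₀ < 3 (truth γ ≈ 1.79; Newman 1986: a jump forces γ ≥ 2, so the content is the window 2 ≤ γ₀ < 3;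
no rigorous upper bound on γ exists in 3 ≤ d ≤ 6);
 (K) FiniteClusterVolumeTail ('Kesten–Zhang at the same p'): for every p with θ(p) > 0 there is c >
0 with P_p(m ≤ |C(0)| < ∞) ≤ exp(−c m^{2/3}) for all m ≥ 1 — the surface-order law of large finite
clusters, a THEOREM for p > p_c (KestenZhang1990 = Grimmett1999 Thm (8.65)); its only new content is
the hypothetical percolating parameter p = p_c.
Assembly (two layers; the glue is elementary and provable now): TRANSFER LEMMA P_p(C(0)=A) =
(1−p)^{|∂A|} g_A(p) with g_A increasing ⇒ P_{p_c}(|C| = m) ≥ e^{−6εm/(1−p_c)} P_{p_c−ε}(|C| = m);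
SIZE SWEEP: if θ(p_c) = θ* > 0, Le Cam on {|C| ≥ n} (|ΔP| ≤ Cε√n) + Markov quantile N(ε) ≤
4χ(p_c−ε)/θ* + pigeonhole give m(ε) → ∞ with P_{p_c}(|C| = m(ε)) ≥ exp(−C m^{1−1/γ₀} − C log m);
since 1 − 1/γ₀ < 2/3 this contradicts (K) at p = p_c. So S → K → PercolationContinuityZ3.
Lean: S := ∃ γ C : ℝ, γ < 3 ∧ ∀ p : unitInterval, (p:ℝ) < criticalProb (zdGraph 3) 0 → ∀ R : ℕ, ∑ x
∈ box 3 R, (bondPercolation (zdGraph 3) p).real (openConn 0 x) ≤ C * (criticalProb (zdGraph 3) 0 −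
p) ^ (−γ); K := ∀ p, 0 < theta (zdGraph 3) 0 p → ∃ c > 0, ∀ m ≥ 1, (bondPercolation (zdGraph 3)
p).real {ω | m ≤ (openCluster ω 0).encard ∧ (openCluster ω 0).Finite} ≤ Real.exp (−(c * m ^ (2/3)))
(both elaborate, planner sketch rc 0).

Rationale: WHY THIS LINE. A jump θ(p_c) = θ* > 0 ANNOUNCES itself below p_c: by Le Cam / Wald–Pinsker on the ≤
6m edges revealed by {|C| ≥ m}, P_{p_c−ε}(|C| ≥ c₀θ*²ε^{−2}) ≥ 3θ*/4 (Newman1986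
doi:10.1007/bf01021076, AizenmanKestenNewmanCMP1987 p.523; in tree: real_clusterSizeGe_le_of_kl,
HutchcroftVolumeTail.lean). The card adds one elementary device — a TRANSFER across p at cost
e^{±Cδm}, legal exactly inside the finite-size window δ·m ≲ 1 (the coupling identity P_p(C=A) =
(1−p)^{|∂A|}g_A(p), g_A increasing; Grimmett1999 §4/§6 animal calculus) — which sweeps the announced
subcritical giant through all sizes m ∈ [c₀θ*²ε^{−2}, 4χ(p_c−ε)/θ*] and deposits at p_c finite
clusters ('debris') of size m with probability ≥ exp(−C m^{1−1/γ₀} − C log m) whenever χ(p) ≤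
C(p_c−p)^{−γ₀}. The same-p partner is the Kesten–Zhang surface-order law P_p(m ≤ |C| < ∞) ≤ exp(−c
m^{2/3}) (doi:10.1214/aop/1176990844; Grimmett1999 Thm (8.65) p.216, held text checked) asked at the
percolating parameter: exchange rate γ₀ < 1/(1 − 2/3) = 3 against the stretched exponent 2/3. The
route thus splits θ(p_c) = 0 into ONE subcritical exponent statement (where tools exist: finite
clusters, Simon–Lieb, OSSS, DuminilcopinKozmaTassion2020 arXiv:1902.03207 ξ ≤ exp(Cε^{−2})) and ONE
same-p supercritical statement, neither mentioning θ(p_c). Refuter audit of the card (2026-08-15)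
checked (1),(2),(2c),(3) on paper and corrected the card's remark (0): the ADS lower bound
Grimmett1999 Thm (8.61) needs only θ(p) > 0, so at a percolating p_c the debris is already
surface-fat, exp(−γm^{2/3}) ≤ P ≤ ? — consistent with (K) being tight-order and leaving the route
intact. Areas imported: statistical decision theory (Le Cam two-point testing budget), FSS-window
transfer, supercritical large-deviation/Wulff technology (KZ 1990, Cerf 2000) as the engine class
for (K). Calibration: Newman 1986 gives γ₀ < 2 ⇒ continuity with NO partner; this route buys the
window [2,3) with (K).

RANKED CRUXES.
 r2 SubcritChiBelowCube (S): the subcritical input; shared target in spirit with cards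
isoperimetry-plus-gamma-lt-3 (G3) and two-arms-exponent-amplifier (SubcritChi) — one decl for all
(dedup by signature). Alternative stronger form (not filed; candidate split child): ν₀ < 1 for the
correlation length (gives exponent 1 − 1/(3ν₀) < 2/3 by the same sweep).
 r3 FiniteClusterVolumeTail (K): KZ at the same p; shared in spirit with quarantine-fat-islands
(KzSameP) and porous-core-deletion-critical (L_{2/3}); carries the conjunct-adjacent weight honestly
(every known proof of the surface law runs through Grimmett–Marstrand).
 Assembly (rank 1) = the DECIDING THEOREM `closes : SubcritChiBelowCube → FiniteClusterVolumeTail →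
DebrisFromChi → PercolationContinuityZ3`, PROVED sorry-free in the route file since rev 3 (~130 Lean
lines of real analysis: θ* := θ(p_c) > 0 ⇒ DebrisFromChi at γ′ := max γ 1 < 3 gives P_{p_c}(|C(0)| =
m) ≥ exp(−C₁(m^{1−1/γ′} + log m)) for infinitely many m, while (K) at the percolating p_c caps
P_{p_c}(m ≤ |C(0)| < ∞) by exp(−c m^{2/3}); 1 − 1/γ′ < 2/3 ⇒ contradiction); the Assembly item is
restated by item names to exactly that arrow type and closes in one line from `closes`. Remaining
provable-now debt: the supports DebrisFromChi (Le Cam + Markov quantile + pigeonhole + transfer;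
hypothesis θ(p_c) > 0 explicit; uses 0 < p_c < 1, in tree; ~250 lines) and TransferLemma (the
coupling identity DebrisFromChi's proof uses, ~150 lines; deliberately NOT a hypothesis of `closes`,
so it cannot block closure); no new definitions ({|C(0)| = m} := (openCluster ω 0).encard = m).
KILL CRITERIA. (i) A Potemkin-type jump world consistent with BK/AKN in which finite clusters at p_c
have tails between exp(−cm^{2/3}) and exp(−Cm^{1−1/γ₀}) for all γ₀ < 3 shows the pair (S,K) cannot
both be attacked by soft means — expected; the bet is that (S) is reachable by subcritical
technology; (ii) a refutation of (K) needs θ(p) > 0 with fat finite-cluster tails at some p —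
impossible for p > p_c (KZ), so only p = p_c in a jump world: unrefutable directly, attack via
consistency portraits; (iii) (S) refuted ⇔ γ ≥ 3 rigorously on ℤ³ — would be sensational (numerics γ
= 1.79).
NOT DECOMPOSED YET. the engine for (S) (reversed Simon–Lieb / OSSS differential inequalities with a
second-moment input); a GM-free proof scheme for (K) (density ⇒ surface tension at η = 0); the
curiosity (4) of the card (continuity ⇒ c_KZ(p_c+ε) = O(ε^{2/3−κ})) — a possible support item later.
CHEAPEST FALSIFIER. (K) at a percolating p_c is the exposed flank: inside a BK/FKG-consistent jump
portrait on ℤ³ (θ(p_c) = θ* > 0, flow constant φ(p_c) = 0 by Zhang 2000 via BGN, θ_{slab k}(p_c) = 0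
for all k) exhibit finite-cluster tails at p_c fatter than exp(−c m^{2/3}) (o(L²) open cut-sets
around B(L) plus linear local uniqueness give debris of size ≍ L³ at cost exp(−o(L²))) — one page of
estimates, no numerics (every statement concerns the counterfactual world) — which refutes
FiniteClusterVolumeTail at p = p_c and closes the route without touching (S). For (S) the only kill
is a rigorous γ ≥ 3 on ℤ³, out of reach (numerics γ ≈ 1.79).
Prior programme: none consulted (plancards mode).

Novelty: Nearest prior art FOUND: doi:10.1007/bf01021076 (Newman 1986: θ discontinuous at p_c ⇒ χ(p) ≥
c(p_c−p)^{−2}, i.e. γ₀ < 2 ⇒ continuity with no partner) and AizenmanKestenNewmanCMP1987 p.523 (the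
announcement of a jump below p_c); doi:10.1214/aop/1176990844 (Kesten–Zhang 1990 = Grimmett1999 Thm
(8.65), p.216 held text read: the surface-order upper bound for p > p_c) and Grimmett1999 Thm (8.61)
(ADS lower bound, needs only θ(p) > 0 — refuter audit); arXiv:1902.03207
(DuminilcopinKozmaTassion2020: ξ ≤ exp(C|p−p_c|^{−2})); doi:10.1007/s00222-020-01011-3
(Hermon–Hutchcroft 2021: the nearest 'transfer across p' technology — p-interpolation of
cluster-size generating functions — which by their own remark is inapplicable on amenable ℤ³).
Delta: the transfer device P_{p}(|C|=m) ≥ e^{−6δm/(1−p)}P_{p−δ}(|C|=m) used INSIDE the finite-size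
window to turn a subcritical quantile of |C| into critical-debris lower bounds, and the resulting
new implication (γ₀ < 3) ∧ (KZ law at a percolating p) ⇒ θ(p_c) = 0 on ℤ³, extending Newman's
partner-free threshold 2 to 3 at the price of one same-p statement; neither found in print. Searches
(2026-08-15): card + refuter audit (crossref/zbMATH 'finite cluster size distribution at percolation
threshold exponential decay first-order', 'transfer across p_c of cluster-size quantiles', 'gamma<3
criteria': Hermon–Hutchcroft nonamenable, Leath 1976, Antunović–Veselić — none at a percolating
p_c); this session: crossref 'cluster size distribution at the percolati  [refs: 10.1007/bf01021076, 10.1214/aop/1176990844, 10.1007/s00222-020-01011-3, 1902.03207, doi:10.1007/bf01021076, doi:10.1214/aop/1176990844, doi:10.1007/s00222-020-01011-3, AizenmanKestenNewmanCMP1987, Grimmett1999, DuminilcopinKozmaTassion2020]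

Barriers (technique_class: parameter-transfer FSS-window subcritical-quantile KZ-law): technique_class: parameter-transfer FSS-window subcritical-quantile KZ-law
- Literature.Barriers.CriticalPhenomena.SprinklingRenormalisation: evaded by the transfer/sweep half
(no renormalisation; the p-shift is PAID for explicitly, e^{6δm/(1−p)}, affordable only inside the
finite-size window δm ≲ 1 — the honest reason the sweep cannot reach m ≫ ε^{−2}·polylog without the
χ bound (S)); HEAD-ON for crux (K): every known proof of the surface-order law (Kesten–Zhang, Cerf's
Wulff LDP) runs through Grimmett–Marstrand at p > p_c; declared in the item's why-might-fail; the
bet is a 'density ⇒ surface tension' argument at η = 0 or a consistency kill of the jump portrait.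
- Literature.Barriers.CriticalPhenomena.LongRangeDiscontinuity: the transfer lemma holds for any
independent model (|∂A| replaced by the boundary weight) and (K)-type laws are insensitive to range;
in Aizenman–Newman 1/r² chains the jump coexists with KT-type χ (γ = ∞), so (S) FAILS there —
consistent, and it locates the ℤ³-specific input in the subcritical exponent bound, exactly as for
Newman-type criteria. Not evaded by structure; evaded by (S) being a d = 3 nearest-neighbour
statement.
- Literature.Barriers.CriticalPhenomena.RandomClusterFirstOrder: a clean first-order FKG transition
(random-cluster q > Q: massive droplets, free/wired coexistence) satisfies the analogue of (K) and
violates nothing soft; the transfer lemma uses PRODUCT structure (g_A increasing and the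
(1−p)^{|∂A|} factorisation), false for q ≠ 1

Novelty grade: new-combination — ROUTE REVIEW g2 = INDEPENDENT RECHECK (2026-08-15; gen-0 stands). Grade new-combination: concur. Literature (crossref+zbMATH; searchd down): the standard inventory of Newman-type inequalities (Grimmett1999 §10.2 notes p.291, held, read: γ≥1 AN84; δ≥2, β≥2/δ; γ,γ'≥2(1−1/δ) Newman 1987c; jump⇒γ≥2 Newm (refuter refuter-rreview-route-HubbardSuperconduc-13ad35dd-g2-0, 2026-08-15T11:33:09Z; prior: doi:10.1007/bf01021076 (Newman 1986: jump ⇒ γ ≥ 2, partner-free threshold 2; acq-00047 cite-only), doi:10.1007/978-1-4613-8734-3_14 + doi:10.1007/bf01206153 (Newman 1987 IMA/JSP: γ,γ' ≥ 2(1−1/δ), β ≥ 2/δ; paywalled acq-02272/acq-01256; inventory read in Grimmett1999 §10.2 notes p.291), AizenmanKestenNewmanCMP1987 doi:10.1007/bf01219071 p.523 (announcement of a jump below p_c), doi:10.1214/aop/1176)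

History (route lifecycle, newest last):
- 2026-08-15T16:21:57Z · rev 3: restated Assembly (stmt-CriticalPhenomena-0946) — route-repair (glue): deciding theorem closes : SubcritChiBelowCube -> FiniteClusterVolumeTail -> DebrisFromChi -> PercolationContinuityZ3 PROVED (~130 lines rea (planner-rbadge-CriticalPhenomena-PercDebrisSwe-98fd78f8-g4-0)

sub-problem: PercolationContinuityZ3 · status: open · opened planner-plancards-CriticalPhenomena-PercolationContinuityZ3-20260815w1-1-0 2026-08-15T10:37:16Z · rev 5 · ledger route-CriticalPhenomena-PercDebrisSweep
GENERATED by the gate from the ledger (D-0016/17). Provers cite these decls: `theorem foo : Summit.CriticalPhenomena.PercolationContinuityZ3.Theses.PercDebrisSweep.<Decl> := …` in Summits/CriticalPhenomena/PercolationContinuityZ3/Theorems/<Name>.lean.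
-/

namespace Summit.CriticalPhenomena.PercolationContinuityZ3.Theses.PercDebrisSweep

open scoped BigOperators Topology Manifold Classical MeasureTheory ProbabilityTheory Matrix InnerProductSpace ComplexConjugate ContinuousMap
open Filter Set Function TopologicalSpace MeasureTheory

attribute [summit_statement] _root_.PercolationContinuityZ3

/-- item stmt-CriticalPhenomena-0942 · crux · rank 2 · open · by planner
why it might fail: No upper bound on γ known for 3≤d≤6 (best χ≤Cξ³≤exp(Cε⁻²), DKT 2020); the one general engine, Hutchcroft's γ≤δ−1, inputs a critical volume tail n^(−1/δ) that already contains θ(p_c)=0; in the jump world to be excluded Newman 1986 forces γ≥2, so S must hit the window [2,3) by a tail-free method.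
sources: Newman1986, doi:10.1007/bf01021076, Hutchcroft2020, arXiv:1901.10363, DuminilcopinKozmaTassion2020, arXiv:1902.03207
[crux] r2 (S): susceptibility exponent below 3 on Z^3: ∃ γ0 < 3, C with sum_{x in B(R)} tau_p(0,x)
<= C (p_c - p)^{-γ0} for all p < p_c and all R (uniform bound on the partial sums = chi(p) <= C
(p_c-p)^{-γ0}; chi := Literature SusceptibilityGammaOne.chi not used to keep the cone minimal).
Truth gamma ~ 1.79, nu ~ 0.88; rigorous: gamma >= 1 (Aizenman-Newman mean-field bound), and IN A
JUMP WORLD gamma >= 2 (Newman1986) — so the content of this crux for the route is the window 2 <= γ0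
< 3. Shared target in spirit with cards isoperimetry-plus-gamma-lt-3 (G3) and
two-arms-exponent-amplifier. Tools: reversed Simon-Lieb / random-walk comparison
(DuminilCopinPanis2024), OSSS differential inequalities, DKT finite-size scheme (arXiv:1902.03207
gives only log chi <~ eps^{-2}). Sources: Newman1986 doi:10.1007/bf01021076;
AizenmanBarskyFernandez1987; DuminilcopinKozmaTassion2020; Hutchcroft arXiv:1901.10363 Thm 1.1
(conditional gamma bounds). -/
@[route_item "route-CriticalPhenomena-PercDebrisSweep"]
def SubcritChiBelowCube : Prop :=
  ∃ γ C : ℝ, γ < 3 ∧ (∀ p : unitInterval, (p : ℝ) < Literature.Probability.Percolation.criticalProb (Literature.Probability.LatticeModels.zdGraph 3) 0 → ∀ R : ℕ, ∑ x ∈ Literature.Probability.LatticeModels.box 3 R, (Literature.Probability.Percolation.bondPercolation (Literature.Probability.LatticeModels.zdGraph 3) p).real (Literature.Probability.Percolation.openConn 0 x) ≤ C * (Literature.Probability.Percolation.criticalProb (Literature.Probability.LatticeModels.zdGraph 3) 0 - (p : ℝ)) ^ (-γ))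

/-- item stmt-CriticalPhenomena-0943 · crux · rank 3 · closed · proved by Summit.CriticalPhenomena.PercolationContinuityZ3.Theorems.PercPorousCriticalFiniteClusterVolumeTail.finiteClusterVolumeTail_proof @ 175ae9e337de (prover) · by planner
why it might fail: New only at a percolating p_c, where every proof (KZ90, Cerf) needs GM blocks at p>p_c (sprinkling barrier head-on) yet θ_{S_k}(p_c)=0 ∀k; and φ(p_c)=0 (Zhang via BGN: o(L²) open edges cut B(L) off), so given linear local uniqueness debris beats e^{−cm^{2/3}}: K(p_c) false in any tame jump world.
sources: doi:10.1214/aop/1176990844, Grimmett1999, GrimmettMarstrand1990, doi:10.24033/ast.502, BarskyGrimmettNewman1991, arXiv:1707.08766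
[crux] r3 (K): Kesten-Zhang surface-order law AT THE SAME p: for every p with theta(p) > 0 there is
c > 0 with P_p(m <= |C(0)| < oo) <= exp(-c m^{2/3}) for all m >= 1 (event written with (openCluster
ω 0).encard and .Finite). A THEOREM for p > p_c (KestenZhang1990 doi:10.1214/aop/1176990844 =
Grimmett1999 Thm (8.65) p.216; Cerf 2000 Wulff LDP), all via Grimmett-Marstrand; the only new
content is the hypothetical percolating p = p_c. Calibration: FALSE for Aizenman-Newman 1/r^2 chains
at their jump (power-law finite-cluster tails), TRUE in the ordered phase of random-cluster q > Q at
p_c(q). Shared in spirit with quarantine-fat-islands (KzSameP) and porous-core-deletion-critical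
(L_{2/3}); by Grimmett1999 Thm (8.61) at a percolating p_c (ADS, needs only theta > 0) the bound
would be tight-order. Sources: doi:10.1214/aop/1176990844; Grimmett1999 Thm (8.65),(8.61);
arXiv:1902.03207. -/
@[route_item "route-CriticalPhenomena-PercDebrisSweep"]
def FiniteClusterVolumeTail : Prop :=
  ∀ p : unitInterval, 0 < Literature.Probability.Percolation.theta (Literature.Probability.LatticeModels.zdGraph 3) 0 p → ∃ c : ℝ, 0 < c ∧ ∀ m : ℕ, 1 ≤ m → (Literature.Probability.Percolation.bondPercolation (Literature.Probability.LatticeModels.zdGraph 3) p).real {ω | (m : ℕ∞) ≤ (Literature.Probability.Percolation.openCluster ω 0).encard ∧ (Literature.Probability.Percolation.openCluster ω 0).Finite} ≤ Real.exp (-(c * (m : ℝ) ^ ((2 : ℝ) / 3)))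

/-- item stmt-CriticalPhenomena-0944 · support · rank 9 · closed · proved by Summit.CriticalPhenomena.PercolationContinuityZ3.Theorems.DebrisTransfer.transferLemma_proof @ 50e8c1faf0c1 (prover) · by planner
sources: Grimmett1999
[support] TRANSFER ACROSS p (provable now, ~100 lines): for q <= p < 1 and every m, P_q(|C(0)| = m)
<= ((1-q)/(1-p))^{6m} P_p(|C(0)| = m). Proof: for a finite vertex set A ∋ 0, {C(0) = A} = {all edges
of the edge boundary of A closed} ∩ {A internally connected by its open edges}, independent, so
P_p(C(0)=A) = (1-p)^{|∂A|} g_A(p) with g_A increasing in p; hence P_q(C=A) <= ((1-q)/(1-p))^{|∂A|}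
P_p(C=A) and |∂A| <= 6|A| on Z^3 ((1-q)/(1-p) >= 1); sum over A with |A| = m (clusterIs o S of
ClusterBoundary.lean may help). Used with p = p_c, q = p_c - eps: P_{p_c}(|C|=m) >= e^{-6 eps
m/(1-p_c)} P_{p_c-eps}(|C|=m). Sources: Grimmett1999 §4.2/§6.3 (animal/boundary calculus); card
debris-sweep-transfer (1). -/
@[route_item "route-CriticalPhenomena-PercDebrisSweep"]
def TransferLemma : Prop :=
  ∀ p q : unitInterval, q ≤ p → (p : ℝ) < 1 → ∀ m : ℕ, (Literature.Probability.Percolation.bondPercolation (Literature.Probability.LatticeModels.zdGraph 3) q).real {ω | (Literature.Probability.Percolation.openCluster ω 0).encard = (m : ℕ∞)} ≤ ((1 - (q : ℝ)) / (1 - (p : ℝ))) ^ (6 * m) * (Literature.Probability.Percolation.bondPercolation (Literature.Probability.LatticeModels.zdGraph 3) p).real {ω | (Literature.Probability.Percolation.openCluster ω 0).encard = (m : ℕ∞)}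

/-- item stmt-CriticalPhenomena-0945 · support · rank 9 · closed · proved by Summit.CriticalPhenomena.PercolationContinuityZ3.Theorems.PercDebrisSweepDebrisFromChi.debrisFromChi_proof @ e8f39eb9a073 (prover) · by planner
sources: doi:10.1007/bf01021076, AizenmanKestenNewmanCMP1987, Grimmett1999
[support] SIZE SWEEP / DEBRIS FROM CHI (provable now, ~250 lines): for γ > 0 and C, if sum_{B(R)}
tau_p(0,x) <= C (p_c-p)^{-γ} for all p < p_c, R, and theta* := theta(p_c) > 0, then for some C' and
infinitely many m: P_{p_c}(|C(0)| = m) >= exp(-C'(m^{1-1/γ} + log m)). Proof: (a) Le Cam/KL on {|C|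
>= n} (<= 6n revealed edges; in tree real_clusterSizeGe_le_of_kl, HutchcroftVolumeTail.lean):
P_{p_c-eps}(|C| >= n(eps)) >= 3 theta*/4 for n(eps) = c0 theta*^2 eps^{-2}, since P_{p_c}(|C| >= n)
>= theta*; (b) Markov: P_{p_c-eps}(|C| > N) <= chi(p_c-eps)/N <= theta*/4 for N(eps) = 4 C
eps^{-γ}/theta*; (c) pigeonhole: some m in [n(eps), N(eps)] has P_{p_c-eps}(|C| = m) >= theta*/(2
N(eps)); (d) TransferLemma up to p_c at cost e^{-6 eps m/(1-p_c)}; (e) m <= N(eps) gives eps <=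
(C''/m)^{1/γ}, so eps m <= C'' m^{1-1/γ} and log(2N/theta*) <= C'' log m; m >= n(eps) -> oo as eps
-> 0 gives infinitely many m. Uses 0 < p_c < 1 (criticalProb_zd_pos / criticalProb_zd_lt_one, in
tree). Sources: doi:10.1007/bf01021076 (Newman 1986); AizenmanKestenNewmanCMP1987 p.523; card
(2),(2c) (checked on paper by the refuter audit). -/
@[route_item "route-CriticalPhenomena-PercDebrisSweep"]
def DebrisFromChi : Prop :=
  ∀ γ C : ℝ, 0 < γ → (∀ p : unitInterval, (p : ℝ) < Literature.Probability.Percolation.criticalProb (Literature.Probability.LatticeModels.zdGraph 3) 0 → ∀ R : ℕ, ∑ x ∈ Literature.Probability.LatticeModels.box 3 R, (Literature.Probability.Percolation.bondPercolation (Literature.Probability.LatticeModels.zdGraph 3) p).real (Literature.Probability.Percolation.openConn 0 x) ≤ C * (Literature.Probability.Percolation.criticalProb (Literature.Probability.LatticeModels.zdGraph 3) 0 - (p : ℝ)) ^ (-γ)) → 0 < Literature.Probability.Percolation.theta (Literature.Probability.LatticeModels.zdGraph 3) 0 (Literature.Probability.Percolation.criticalProbI 3) → ∃ C' : ℝ,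 ∃ᶠ m : ℕ in Filter.atTop, Real.exp (-(C' * ((m : ℝ) ^ (1 - 1 / γ) + Real.log (m : ℝ)))) ≤ (Literature.Probability.Percolation.bondPercolation (Literature.Probability.LatticeModels.zdGraph 3) (Literature.Probability.Percolation.criticalProbI 3)).real {ω | (Literature.Probability.Percolation.openCluster ω 0).encard = (m : ℕ∞)}

-- earlier Assembly (stmt-CriticalPhenomena-0946, replaced 2026-08-15T16:21:57Z -> stmt-CriticalPhenomena-10720): retired by None — (∃ γ C : ℝ, γ < 3 ∧ (∀ p : unitInterval, (p : ℝ) < Literature.Probability.Percolation.criticalProb (Literature.Probability.LatticeModels.zdGraph 3) 0 → ∀ R : ℕ, ∑ x ∈ Literature.Probability.LatticeModels.box 3 R, (Literature.Probability.Percolation.bondPercolation (Liter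
/-- item stmt-CriticalPhenomena-10720 · assembly · rank 1 · closed · proved by Summit.CriticalPhenomena.PercolationContinuityZ3.Theorems.PercDebrisSweepAssembly.assembly_proof @ 92bb82197b47 (prover) · by planner
sources: doi:10.1007/bf01021076, doi:10.1214/aop/1176990844, Grimmett1999
[assembly] S → K → D → θ(p_c(ℤ³)) = 0, stated BY ITEM NAMES; this is exactly the type of the
deciding theorem `closes` proved in this file (jump θ* > 0 ⇒ DebrisFromChi at γ′ := max γ 1 < 3
gives debris mass ≥ exp(−C₁(m^{1−1/γ′} + log m)) at p_c for infinitely many m;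
FiniteClusterVolumeTail at the percolating p_c caps it by exp(−c m^{2/3}); 1 − 1/γ′ < 2/3 ⇒
contradiction), so it is closable in one line: `fun hS hK hD => closes hS hK hD`. Supersedes the
rev-2 inline spelling (S-body → K-body → Z3) that the audit read as extra hypotheses. TransferLemma
is the lemma behind DebrisFromChi and deliberately not a hypothesis here. -/
@[route_item "route-CriticalPhenomena-PercDebrisSweep"]
def Assembly : Prop :=
  SubcritChiBelowCube → FiniteClusterVolumeTail → DebrisFromChi → PercolationContinuityZ3

/-! D-0027 §2.1 — DECIDING THEOREM (planner-authored via `route open/edit --closes-file`; by planner-rbadge-CriticalPhenomena-PercDebrisSwe-98fd78f8-g4-0 2026-08-15T16:23:42Z):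
its hypotheses are this route's items and its conclusion the sub-problem Statement (glue_lint), and it elaborates with this file. -/

@[closes "route-CriticalPhenomena-PercDebrisSweep"] theorem closes (hS : SubcritChiBelowCube) (hK : FiniteClusterVolumeTail) (hD : DebrisFromChi) :
    _root_.PercolationContinuityZ3 := by
  /- The size sweep, assembled: (S) a subcritical susceptibility exponent γ < 3, (K) the Kesten–Zhang
     surface-order law `P_p(m ≤ |C(0)| < ∞) ≤ exp(-c m^{2/3})` at every percolating `p`, and the support
     (D) = DebrisFromChi (Le Cam + Markov quantile + pigeonhole + transfer across `p`, whose own proof uses the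
     support item `TransferLemma`) are contradictory with a jump `θ(p_c) > 0`: (D) deposits at `p_c` finite
     clusters of infinitely many sizes `m` with mass `≥ exp(-C₁ (m^{1-1/γ'} + log m))`, `γ' = max γ 1 < 3`,
     while (K) at `p = p_c` caps that mass by `exp(-c m^{2/3})`, and `1 - 1/γ' < 2/3`. Pure real analysis
     below; no percolation estimate is proved here. -/
  classical
  -- `θ(p_c) = 0` on `ℤ³` is `theta (zdGraph 3) 0 (criticalProbI 3) = 0` (`Iff.rfl`); argue by contradiction.
  refine Literature.Probability.Percolation.percolationContinuityZ3_iff.mpr ?_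
  by_contra hne
  -- a jump: θ* := θ(p_c) > 0
  have hθ : 0 < Literature.Probability.Percolation.theta
      (Literature.Probability.LatticeModels.zdGraph 3) 0
      (Literature.Probability.Percolation.criticalProbI 3) := by
    refine lt_of_le_of_ne ?_ (Ne.symm hne)
    unfold Literature.Probability.Percolation.theta
    exact MeasureTheory.measureReal_nonneg
  -- (S): χ(p) ≤ C (p_c - p)^{-γ} with γ < 3; upgrade to γ' := max γ 1 ∈ [1, 3) and C' := max C 0
  obtain ⟨γ, C, hγ3, hchi⟩ := hS
  have hγ'1 : (1 : ℝ) ≤ max γ 1 := le_max_right _ _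
  have hγ'pos : (0 : ℝ) < max γ 1 := lt_of_lt_of_le one_pos hγ'1
  have hγ'3 : max γ 1 < (3 : ℝ) := max_lt hγ3 (by norm_num)
  have hchi' : ∀ p : unitInterval, (p : ℝ) < Literature.Probability.Percolation.criticalProb
      (Literature.Probability.LatticeModels.zdGraph 3) 0 → ∀ R : ℕ,
      ∑ x ∈ Literature.Probability.LatticeModels.box 3 R,
        (Literature.Probability.Percolation.bondPercolation
          (Literature.Probability.LatticeModels.zdGraph 3) p).real
          (Literature.Probability.Percolation.openConn 0 x)
        ≤ max C 0 * (Literature.Probability.Percolation.criticalProb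
          (Literature.Probability.LatticeModels.zdGraph 3) 0 - (p : ℝ)) ^ (-(max γ 1)) := by
    intro p hp R
    have ht0 : 0 < Literature.Probability.Percolation.criticalProb
        (Literature.Probability.LatticeModels.zdGraph 3) 0 - (p : ℝ) := sub_pos.mpr hp
    have ht1 : Literature.Probability.Percolation.criticalProb
        (Literature.Probability.LatticeModels.zdGraph 3) 0 - (p : ℝ) ≤ 1 :=
      (sub_le_self _ p.2.1).trans (Literature.Probability.Percolation.criticalProb_mem_Icc _ _).2
    calc ∑ x ∈ Literature.Probability.LatticeModels.box 3 R,
          (Literature.Probability.Percolation.bondPercolation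
            (Literature.Probability.LatticeModels.zdGraph 3) p).real
            (Literature.Probability.Percolation.openConn 0 x)
        ≤ C * (Literature.Probability.Percolation.criticalProb
            (Literature.Probability.LatticeModels.zdGraph 3) 0 - (p : ℝ)) ^ (-γ) := hchi p hp R
      _ ≤ max C 0 * (Literature.Probability.Percolation.criticalProb
            (Literature.Probability.LatticeModels.zdGraph 3) 0 - (p : ℝ)) ^ (-γ) :=
          mul_le_mul_of_nonneg_right (le_max_left _ _) (Real.rpow_nonneg ht0.le _)
      _ ≤ max C 0 * (Literature.Probability.Percolation.criticalProb
            (Literature.Probability.LatticeModels.zdGraph 3) 0 - (p : ℝ)) ^ (-(max γ 1)) :=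
          mul_le_mul_of_nonneg_left
            (Real.rpow_le_rpow_of_exponent_ge ht0 ht1 (neg_le_neg (le_max_left γ 1)))
            (le_max_right _ _)
  -- (D) DebrisFromChi at (γ', C'): infinitely many sizes m carry debris mass ≥ exp(-C₁ (m^{1-1/γ'} + log m)) at p_c
  obtain ⟨C₁, hfreq⟩ := hD (max γ 1) (max C 0) hγ'pos hchi' hθ
  -- (K) the surface-order law at the (hypothetically percolating) parameter p_c
  obtain ⟨c, hc, hKZ⟩ := hK (Literature.Probability.Percolation.criticalProbI 3) hθ
  -- exponent bookkeeping: 0 ≤ 1 - 1/γ' < 2/3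
  have ha : 1 - 1 / max γ 1 < (2 : ℝ) / 3 := by
    have h13 : (1 : ℝ) / 3 < 1 / max γ 1 := one_div_lt_one_div_of_lt hγ'pos hγ'3
    linarith
  -- eventually (in the size m) the KZ upper bound is STRICTLY below the debris lower bound
  have hreal : ∀ᶠ x : ℝ in Filter.atTop,
      C₁ * (x ^ (1 - 1 / max γ 1) + Real.log x) < c * x ^ ((2 : ℝ) / 3) := by
    rcases le_or_gt C₁ 0 with hC₁ | hC₁
    · filter_upwards [Filter.eventually_ge_atTop (1 : ℝ)] with x hx
      have hx0 : 0 < x := lt_of_lt_of_le one_pos hx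
      have h1 : 0 ≤ x ^ (1 - 1 / max γ 1) + Real.log x :=
        add_nonneg (Real.rpow_nonneg hx0.le _) (Real.log_nonneg hx)
      have h2 : 0 < c * x ^ ((2 : ℝ) / 3) := mul_pos hc (Real.rpow_pos_of_pos hx0 _)
      exact lt_of_le_of_lt (mul_nonpos_of_nonpos_of_nonneg hC₁ h1) h2
    · have hε : 0 < c / (4 * C₁) := by positivity
      -- power part: x^{a} = x^{-(2/3 - a)} · x^{2/3} with x^{-(2/3-a)} → 0
      have hpow : ∀ᶠ x : ℝ in Filter.atTop,
          x ^ (1 - 1 / max γ 1) ≤ c / (4 * C₁) * x ^ ((2 : ℝ) / 3) := by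
        have ht : Filter.Tendsto (fun x : ℝ => x ^ (-((2 : ℝ) / 3 - (1 - 1 / max γ 1))))
            Filter.atTop (nhds 0) := tendsto_rpow_neg_atTop (by linarith)
        filter_upwards [ht.eventually (gt_mem_nhds hε), Filter.eventually_gt_atTop (0 : ℝ)]
          with x hx hx0
        have hsplit : x ^ (1 - 1 / max γ 1)
            = x ^ (-((2 : ℝ) / 3 - (1 - 1 / max γ 1))) * x ^ ((2 : ℝ) / 3) := by
          rw [← Real.rpow_add hx0]
          congr 1
          ring
        rw [hsplit]
        exact mul_le_mul_of_nonneg_right hx.le (Real.rpow_nonneg hx0.le _)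
      -- logarithmic part: log x = o(x^{2/3})
      have hlog : ∀ᶠ x : ℝ in Filter.atTop, Real.log x ≤ c / (4 * C₁) * x ^ ((2 : ℝ) / 3) := by
        filter_upwards [(isLittleO_log_rpow_atTop (show (0 : ℝ) < 2 / 3 by norm_num)).def hε,
          Filter.eventually_ge_atTop (1 : ℝ)] with x hx hx1
        rw [Real.norm_of_nonneg (Real.log_nonneg hx1),
          Real.norm_of_nonneg (Real.rpow_nonneg (zero_le_one.trans hx1) _)] at hx
        exact hx
      filter_upwards [hpow, hlog, Filter.eventually_gt_atTop (0 : ℝ)] with x hx1 hx2 hx0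
      have hx23 : 0 < x ^ ((2 : ℝ) / 3) := Real.rpow_pos_of_pos hx0 _
      have hsum : x ^ (1 - 1 / max γ 1) + Real.log x ≤ c / (2 * C₁) * x ^ ((2 : ℝ) / 3) := by
        have : c / (4 * C₁) * x ^ ((2 : ℝ) / 3) + c / (4 * C₁) * x ^ ((2 : ℝ) / 3)
            = c / (2 * C₁) * x ^ ((2 : ℝ) / 3) := by
          field_simp
          ring
        linarith
      calc C₁ * (x ^ (1 - 1 / max γ 1) + Real.log x)
          ≤ C₁ * (c / (2 * C₁) * x ^ ((2 : ℝ) / 3)) := mul_le_mul_of_nonneg_left hsum hC₁.le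
        _ = c / 2 * x ^ ((2 : ℝ) / 3) := by
          field_simp
        _ < c * x ^ ((2 : ℝ) / 3) := by nlinarith
  have hev : ∀ᶠ m : ℕ in Filter.atTop, 1 ≤ m ∧
      C₁ * ((m : ℝ) ^ (1 - 1 / max γ 1) + Real.log (m : ℝ)) < c * (m : ℝ) ^ ((2 : ℝ) / 3) := by
    filter_upwards [(tendsto_natCast_atTop_atTop (R := ℝ)).eventually hreal,
      Filter.eventually_ge_atTop 1] with m hm h1
    exact ⟨h1, hm⟩
  -- pick one such size m where debris is also present, and compare
  obtain ⟨m, hdebris, h1, hlt⟩ := (hfreq.and_eventually hev).exists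
  have hmono : (Literature.Probability.Percolation.bondPercolation
        (Literature.Probability.LatticeModels.zdGraph 3)
        (Literature.Probability.Percolation.criticalProbI 3)).real
        {ω | (Literature.Probability.Percolation.openCluster ω 0).encard = (m : ℕ∞)}
      ≤ (Literature.Probability.Percolation.bondPercolation
        (Literature.Probability.LatticeModels.zdGraph 3)
        (Literature.Probability.Percolation.criticalProbI 3)).real
        {ω | (m : ℕ∞) ≤ (Literature.Probability.Percolation.openCluster ω 0).encard ∧
          (Literature.Probability.Percolation.openCluster ω 0).Finite} := by
    refine MeasureTheory.measureReal_mono ?_ (MeasureTheory.measure_ne_top _ _)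
    intro ω hω
    simp only [Set.mem_setOf_eq] at hω ⊢
    exact ⟨hω.ge, Set.finite_of_encard_eq_coe hω⟩
  have hchain := (hdebris.trans hmono).trans (hKZ m h1)
  have hstrict : Real.exp (-(c * (m : ℝ) ^ ((2 : ℝ) / 3)))
      < Real.exp (-(C₁ * ((m : ℝ) ^ (1 - 1 / max γ 1) + Real.log (m : ℝ)))) :=
    Real.exp_lt_exp.mpr (neg_lt_neg hlt)
  exact absurd (hchain.trans_lt hstrict) (lt_irrefl _)

end Summit.CriticalPhenomena.PercolationContinuityZ3.Theses.PercDebrisSweep
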